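import Mathlib
import Literature.Probability.LatticeModels.IndependencePolynomialProofs
import Literature.Analysis.Complex.BarvinokInterpolation
import Literature.Analysis.Complex.BarvinokDiscToStrip
import Literature.Combinatorics.SimpleGraph.TreeDecomposition
import Summits.PneNP.PneNP.Theses.PhaseTwins
import Summits.PneNP.PneNP.Theorems.PhaseTwinsDensityContinuityBelowHomCount

/-!
# Route PhaseTwins — support item `LogDepthContinuityBelow` (stmt-PneNP-2724)

`Summit.PneNP.PneNP.Theses.PhaseTwins.LogDepthContinuityBelow`: for `Δ ≥ 3`, `0 ≤ λ < λ_c(Δ)`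
and `ε > 0` there is `C` such that two graphs `G`, `H` on `Fin n` of maximum degree `≤ Δ` that
are homomorphism-indistinguishable over all graphs of treewidth `< C log n` satisfy
`Z_G(λ) ≤ (1 + ε) Z_H(λ)`, `Z` the independence polynomial (`logDepthContinuityBelow_proof`).

Proof (the planner's plan; every analytic ingredient is PROVED in the tree):
* Peters–Regts (`PetersRegts2019_zeroFree_holds`, `….exists_thickening`): a uniform
  `δ`-neighbourhood of `[0, λ]` is zero-free for `Z_G`, `G` of maximum degree `≤ Δ`;
* Barvinok's disc-to-strip polynomial (`DiscToStrip.exists_polynomial_disc_to_strip`): `φ` with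
  `φ(0) = 0`, `φ(1) = 1` maps the disc `‖z‖ ≤ β`, `β > 1`, into the `4λρ < δ` neighbourhood,
  so `P_G(z) = Z_G(λ φ(z)) = ∑_{I independent} (λ φ(z))^{|I|}` (written inline as a polynomial,
  no definition) has no zeros in the disc (`eval_interp_ne_zero`), degree `≤ n · deg φ`
  (`natDegree_interp_le`), and `P_G(1) = Z_G(λ)` (`eval_interp`);
* the coefficients of `P_G` in degrees `≤ m` only depend on the numbers `i_j(G)`, `j ≤ m`, of
  independent `j`-sets (`coeff_interp_eq_sum_range`), and these agree for `G`, `H` as soon as the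
  homomorphism counts from graphs on `≤ m` vertices agree
  (`DensityContinuityBelow.natCard_indepSets_eq_of_homCount_eq`, the sibling item's helper file,
  reused), such graphs having treewidth `≤ m - 1` (`treewidth_le_card_sub_one`);
* Barvinok's interpolation lemma with Newton's identities
  (`abs_log_norm_eval_sub_log_norm_eval_le`): `|log Z_G(λ) - log Z_H(λ)| ≤ 2 n deg φ /
  ((m+1) β^m (β-1))` with `m = ⌊C log n⌋`, which is `< log (1 + ε)` for
  `C = (1 + M / log 2) / log β`, `M = 2 deg φ · β / ((β - 1) log (1 + ε))` and every `n ≥ 2`;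
  for `n ≤ 1` there is only one graph on `Fin n`.
-/

namespace Summit.PneNP.PneNP.Theorems

open Finset Polynomial
open scoped Classical
open Literature.Probability.LatticeModels
open Literature.Analysis.Complex
open Literature.Combinatorics.SimpleGraph (treewidth treewidth_le_card_sub_one)

-- `Summit.PneNP.PneNP.…` (summit name = sub-problem name, D-0017) trips the duplicate-namespace
-- linter on every declaration of this file.
set_option linter.dupNamespace false

/-! ## Sums over independent sets, grouped by cardinality -/

section Fiberwise

variable {V : Type*} [Fintype V] [DecidableEq V] (G : SimpleGraph V)

/-- A sum over the independent sets `I` of a quantity `g |I|` that vanishes for `|I| > k`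
equals `∑_{j ≤ k} i_j(G) · g j`, `i_j(G)` the number of independent `j`-sets. [folklore] -/
theorem sum_ite_isIndepSet_eq_sum_range {R : Type*} [CommSemiring R] (g : ℕ → R) (k : ℕ)
    (hg : ∀ j, k < j → g j = 0) :
    (∑ I : Finset V, if G.IsIndepSet (↑I : Set V) then g I.card else 0)
      = ∑ j ∈ range (k + 1), (Nat.card {I : Finset V // G.IsIndepSet ↑I ∧ I.card = j} : R) * g j := by
  rw [← sum_filter]
  have h1 : ∑ I ∈ univ.filter (fun I : Finset V => G.IsIndepSet (↑I : Set V)), g I.card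
      = ∑ I ∈ univ.filter (fun I : Finset V => G.IsIndepSet (↑I : Set V) ∧ I.card ≤ k),
          g I.card := by
    symm
    apply sum_subset
    · intro I
      simp only [mem_filter, mem_univ, true_and]
      exact fun h => h.1
    · intro I hI hI'
      simp only [mem_filter, mem_univ, true_and, not_and, not_le] at hI hI'
      exact hg _ (hI' hI)
  rw [h1, ← sum_fiberwise_of_maps_to' (g := fun I : Finset V => I.card) (t := range (k + 1))]
  · refine sum_congr rfl fun j hj => ?_
    have hj' : j < k + 1 := mem_range.1 hj
    have hset : (univ.filter (fun I : Finset V => G.IsIndepSet (↑I : Set V) ∧ I.card ≤ k)).filter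
          (fun I : Finset V => I.card = j)
        = univ.filter (fun I : Finset V => G.IsIndepSet (↑I : Set V) ∧ I.card = j) := by
      rw [filter_filter]
      exact filter_congr fun I _ => ⟨fun h => ⟨h.1.1, h.2⟩, fun h => ⟨⟨h.1, by omega⟩, h.2⟩⟩
    rw [sum_const, nsmul_eq_mul, hset, Nat.card_eq_fintype_card, Fintype.card_subtype]
  · intro I hI
    simp only [mem_filter, mem_univ, true_and] at hI
    exact mem_range.2 (by omega)

end Fiberwise

/-! ## The interpolating polynomial `P_G(z) = Z_G(c · φ(z))` -/

section Interp

variable {n : ℕ} (G : SimpleGraph (Fin n)) (c : ℂ) (φ : ℂ[X])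

/-- `P_G(z) = Z_G(c φ(z))`. [folklore] -/
theorem eval_interp (z : ℂ) :
    (∑ I : Finset (Fin n), if G.IsIndepSet (↑I : Set (Fin n)) then (C c * φ) ^ I.card else 0).eval z
      = independencePolynomial G (c * φ.eval z) := by
  rw [eval_finsetSum, independencePolynomial]
  refine sum_congr rfl fun I _ => ?_
  split_ifs
  · rw [eval_pow, eval_mul, eval_C]
  · rw [eval_zero]

/-- `deg P_G ≤ n · deg φ`. [folklore] -/
theorem natDegree_interp_le :
    (∑ I : Finset (Fin n), if G.IsIndepSet (↑I : Set (Fin n)) then (C c * φ) ^ I.card else 0).natDegree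
      ≤ n * φ.natDegree := by
  refine natDegree_sum_le_of_forall_le _ _ fun I _ => ?_
  split_ifs
  · calc ((C c * φ) ^ I.card).natDegree ≤ I.card * (C c * φ).natDegree := natDegree_pow_le
      _ ≤ n * φ.natDegree := by
          refine Nat.mul_le_mul ?_ (natDegree_C_mul_le _ _)
          simpa using I.card_le_univ
  · simp

/-- The coefficients of `(c φ)^j` vanish below degree `j` when `φ(0) = 0`. [folklore] -/
theorem coeff_C_mul_pow_eq_zero (hφ0 : φ.eval 0 = 0) {i j : ℕ} (hij : i < j) :
    ((C c * φ) ^ j).coeff i = 0 := by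
  obtain ⟨ψ, hψ⟩ : X ∣ φ := X_dvd_iff.2 (by rwa [coeff_zero_eq_eval_zero])
  rw [mul_pow, ← C_pow, coeff_C_mul, hψ, mul_pow, coeff_X_pow_mul', if_neg (by omega), mul_zero]

/-- **The low coefficients of `P_G` are determined by the small independent-set counts**: for
`φ(0) = 0`, `[z^i] P_G = ∑_{j ≤ i} i_j(G) · [z^i] (c φ)^j`. [folklore] -/
theorem coeff_interp_eq_sum_range (hφ0 : φ.eval 0 = 0) (i : ℕ) :
    (∑ I : Finset (Fin n), if G.IsIndepSet (↑I : Set (Fin n)) then (C c * φ) ^ I.card else 0).coeff i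
      = ∑ j ∈ range (i + 1),
          (Nat.card {I : Finset (Fin n) // G.IsIndepSet ↑I ∧ I.card = j} : ℂ)
            * ((C c * φ) ^ j).coeff i := by
  rw [finsetSum_coeff]
  have h : ∀ I : Finset (Fin n),
      (if G.IsIndepSet (↑I : Set (Fin n)) then (C c * φ) ^ I.card else 0).coeff i
        = if G.IsIndepSet (↑I : Set (Fin n)) then ((C c * φ) ^ I.card).coeff i else 0 := by
    intro I
    split_ifs <;> simp
  simp only [h]
  exact sum_ite_isIndepSet_eq_sum_range G (fun j => ((C c * φ) ^ j).coeff i) i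
    (fun j hj => coeff_C_mul_pow_eq_zero c φ hφ0 hj)

/-- Hence graphs with the same small independent-set counts have interpolating polynomials with
the same low coefficients. [folklore] -/
theorem coeff_interp_eq_of_card_indepSets_eq (H : SimpleGraph (Fin n)) (hφ0 : φ.eval 0 = 0)
    {m : ℕ}
    (hcount : ∀ j ≤ m, Nat.card {I : Finset (Fin n) // G.IsIndepSet ↑I ∧ I.card = j}
      = Nat.card {I : Finset (Fin n) // H.IsIndepSet ↑I ∧ I.card = j})
    {i : ℕ} (hi : i ≤ m) :
    (∑ I : Finset (Fin n), if G.IsIndepSet (↑I : Set (Fin n)) then (C c * φ) ^ I.card else 0).coeff i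
      = (∑ I : Finset (Fin n),
          if H.IsIndepSet (↑I : Set (Fin n)) then (C c * φ) ^ I.card else 0).coeff i := by
  rw [coeff_interp_eq_sum_range G c φ hφ0, coeff_interp_eq_sum_range H c φ hφ0]
  refine sum_congr rfl fun j hj => ?_
  rw [hcount j (by have := mem_range.1 hj; omega)]

end Interp

/-! ## Zero-freeness of `P_G` on the disc -/

/-- A point of the rectangle `-ρ ≤ Re u ≤ 1 + 2ρ`, `|Im u| ≤ 2ρ` is within `4ρ` of the segment
`[0, 1]`: of the point `max 0 (min (Re u) 1)`. [folklore] -/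
theorem norm_sub_clamp_le {u : ℂ} {ρ : ℝ} (hρ : 0 ≤ ρ) (h1 : -ρ ≤ u.re) (h2 : u.re ≤ 1 + 2 * ρ)
    (h3 : |u.im| ≤ 2 * ρ) :
    ‖u - ((max 0 (min u.re 1) : ℝ) : ℂ)‖ ≤ 4 * ρ := by
  have hre : |u.re - max 0 (min u.re 1)| ≤ 2 * ρ := by
    rcases le_total u.re 1 with hu1 | hu1
    · rw [min_eq_left hu1]
      rcases le_total 0 u.re with hu0 | hu0
      · rw [max_eq_right hu0, sub_self, abs_zero]
        positivity
      · rw [max_eq_left hu0, sub_zero, abs_of_nonpos hu0]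
        linarith
    · rw [min_eq_right hu1, max_eq_right zero_le_one, abs_of_nonneg (by linarith)]
      linarith
  calc ‖u - ((max 0 (min u.re 1) : ℝ) : ℂ)‖
      ≤ |(u - ((max 0 (min u.re 1) : ℝ) : ℂ)).re| + |(u - ((max 0 (min u.re 1) : ℝ) : ℂ)).im| :=
        Complex.norm_le_abs_re_add_abs_im _
    _ = |u.re - max 0 (min u.re 1)| + |u.im| := by
        simp [Complex.sub_re, Complex.sub_im, Complex.ofReal_re, Complex.ofReal_im]
    _ ≤ 2 * ρ + 2 * ρ := add_le_add hre h3
    _ = 4 * ρ := by ring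

/-- **`P_G` has no zeros in the disc `‖z‖ ≤ β`**: `φ` maps the disc into the rectangle around
`[0, 1]`, so `λ φ(z)` lies within `4λρ < δ` of a point of `[0, λ]`, where `Z_G ≠ 0` by the
Peters–Regts theorem (in its thickened form). [folklore] -/
theorem eval_interp_ne_zero {n : ℕ} (G : SimpleGraph (Fin n)) {lam δ ρ β : ℝ} (φ : ℂ[X])
    (hlam : 0 ≤ lam) (hρ : 0 ≤ ρ) (hρδ : 4 * lam * ρ < δ)
    (hzero : ∀ (z : ℂ) (t : ℝ), 0 ≤ t → t ≤ lam → dist z (t : ℂ) < δ →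
      independencePolynomial G z ≠ 0)
    (hstrip : ∀ z : ℂ, ‖z‖ ≤ β →
      -ρ ≤ (φ.eval z).re ∧ (φ.eval z).re ≤ 1 + 2 * ρ ∧ |(φ.eval z).im| ≤ 2 * ρ)
    {z : ℂ} (hz : ‖z‖ ≤ β) :
    (∑ I : Finset (Fin n),
        if G.IsIndepSet (↑I : Set (Fin n)) then (C (lam : ℂ) * φ) ^ I.card else 0).eval z ≠ 0 := by
  rw [eval_interp]
  obtain ⟨h1, h2, h3⟩ := hstrip z hz
  set s : ℝ := max 0 (min (φ.eval z).re 1) with hs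
  have hs0 : 0 ≤ s := le_max_left _ _
  have hs1 : s ≤ 1 := max_le zero_le_one (min_le_right _ _)
  refine hzero _ (lam * s) (mul_nonneg hlam hs0) (mul_le_of_le_one_right hlam hs1) ?_
  rw [dist_eq_norm]
  calc ‖(lam : ℂ) * φ.eval z - ((lam * s : ℝ) : ℂ)‖ = ‖(lam : ℂ) * (φ.eval z - (s : ℂ))‖ := by
        push_cast
        ring_nf
    _ = lam * ‖φ.eval z - (s : ℂ)‖ := by
        rw [norm_mul, Complex.norm_real, Real.norm_of_nonneg hlam]
    _ ≤ lam * (4 * ρ) := mul_le_mul_of_nonneg_left (norm_sub_clamp_le hρ h1 h2 h3) hlam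
    _ = 4 * lam * ρ := by ring
    _ < δ := hρδ

/-! ## The constants and the main estimate -/

/-- Graphs on at most one vertex coincide. [folklore] -/
theorem simpleGraph_eq_of_lt_two {n : ℕ} (hn : n < 2) (G H : SimpleGraph (Fin n)) : G = H := by
  ext a b
  have hab : a = b := Fin.ext (by omega)
  subst hab
  exact ⟨fun h => (G.irrefl h).elim, fun h => (H.irrefl h).elim⟩

/-- The route's inlined sum is the independence polynomial of the tree. [folklore] -/
theorem sum_ite_isIndepSet_eq_independencePolynomial {n : ℕ} (G : SimpleGraph (Fin n)) (lam : ℝ) :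
    (∑ I : Finset (Fin n), if G.IsIndepSet (↑I : Set (Fin n)) then lam ^ I.card else 0)
      = independencePolynomial G lam := rfl

/-- **The key exponent estimate.** With `C = (1 + M / log 2) / log β`, `M ≥ 0`, `β > 1`, `n ≥ 2`
and `K = ⌊C log n⌋`: `n e^M < β^(K+1)`. [folklore] -/
theorem mul_exp_lt_pow_floor {β M : ℝ} (hβ : 1 < β) (hM : 0 ≤ M) {n : ℕ} (hn : 2 ≤ n) :
    (n : ℝ) * Real.exp M < β ^ (⌊(1 + M / Real.log 2) / Real.log β * Real.log n⌋₊ + 1) := by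
  set K : ℕ := ⌊(1 + M / Real.log 2) / Real.log β * Real.log n⌋₊ with hK
  have hβ0 : 0 < β := one_pos.trans hβ
  have hlogβ : 0 < Real.log β := Real.log_pos hβ
  have hn0 : (0 : ℝ) < n := by exact_mod_cast (show 0 < n by omega)
  have hlog2 : 0 < Real.log 2 := Real.log_pos one_lt_two
  have hlogn : Real.log 2 ≤ Real.log n := Real.log_le_log two_pos (by exact_mod_cast hn)
  have hK1 : (1 + M / Real.log 2) / Real.log β * Real.log n < (K : ℝ) + 1 := Nat.lt_floor_add_one _
  have h1 : (1 + M / Real.log 2) * Real.log n < ((K : ℝ) + 1) * Real.log β := by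
    have := mul_lt_mul_of_pos_right hK1 hlogβ
    rwa [div_mul_eq_mul_div, div_mul_cancel₀ _ hlogβ.ne'] at this
  have h2 : Real.exp ((1 + M / Real.log 2) * Real.log n) < β ^ (K + 1) := by
    calc Real.exp ((1 + M / Real.log 2) * Real.log n)
        < Real.exp (((K : ℝ) + 1) * Real.log β) := Real.exp_lt_exp.2 h1
      _ = β ^ (K + 1) := by
          rw [← Nat.cast_add_one, Real.exp_nat_mul, Real.exp_log hβ0]
  refine lt_of_le_of_lt ?_ h2
  rw [add_mul, one_mul, Real.exp_add, Real.exp_log hn0]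
  refine mul_le_mul_of_nonneg_left (Real.exp_le_exp.2 ?_) hn0.le
  calc M = M / Real.log 2 * Real.log 2 := (div_mul_cancel₀ M hlog2.ne').symm
    _ ≤ M / Real.log 2 * Real.log n := mul_le_mul_of_nonneg_left hlogn (div_nonneg hM hlog2.le)

/-- **The error term is below `log (1 + ε)`**: with `L = log (1 + ε) > 0`,
`M = 2 D β / (L (β - 1))`, `K` as in `mul_exp_lt_pow_floor` and `N ≤ 2 D n`:
`N / ((K+1) β^K (β-1)) < L`. [folklore] -/
theorem error_lt {β L N : ℝ} {D n K : ℕ} (hβ : 1 < β) (hL : 0 < L) (hN : N ≤ 2 * D * n)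
    (hK : (n : ℝ) * Real.exp (2 * D * β / (L * (β - 1))) < β ^ (K + 1)) :
    N / ((K + 1) * β ^ K * (β - 1)) < L := by
  set M : ℝ := 2 * D * β / (L * (β - 1)) with hM
  have hβ0 : 0 < β := one_pos.trans hβ
  have hβ1 : 0 < β - 1 := sub_pos.2 hβ
  have hD : (0 : ℝ) ≤ D := D.cast_nonneg
  have hn : (0 : ℝ) ≤ n := n.cast_nonneg
  have hM0 : 0 ≤ M := by positivity
  have hden : 0 < ((K : ℝ) + 1) * β ^ K * (β - 1) := by positivity
  rw [div_lt_iff₀ hden]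
  have hexp : 1 + M ≤ Real.exp M := by linarith [Real.add_one_le_exp M]
  have hLM : L * (β - 1) * M = 2 * D * β := by
    rw [hM]
    field_simp
  calc N ≤ 2 * D * n := hN
    _ ≤ 2 * D * n + L * (β - 1) * n / β := le_add_of_nonneg_right (by positivity)
    _ = L * (β - 1) * (n * (1 + M)) / β := by
        rw [show L * (β - 1) * (n * (1 + M)) = L * (β - 1) * n + L * (β - 1) * M * n by ring, hLM]
        field_simp
        ring
    _ ≤ L * (β - 1) * (n * Real.exp M) / β := by
        gcongr
    _ < L * (β - 1) * β ^ (K + 1) / β := by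
        gcongr
    _ = L * (1 * β ^ K * (β - 1)) := by
        rw [pow_succ]
        field_simp
    _ ≤ L * ((K + 1) * β ^ K * (β - 1)) := by
        gcongr
        linarith [(K.cast_nonneg : (0 : ℝ) ≤ K)]

/-! ## The theorem -/

/-- **Settles `stmt-PneNP-2724` (`LogDepthContinuityBelow`, route PhaseTwins).** For `Δ ≥ 3`,
`0 ≤ λ < λ_c(Δ) = (Δ-1)^{Δ-1}/(Δ-2)^Δ` and `ε > 0` there is `C` (namely
`C = (1 + M / log 2) / log β` with Barvinok's radius `β = β(ρ) > 1`, `ρ = δ / (4λ + 2δ)`, `δ` the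
Peters–Regts zero-free margin of `[0, λ]`, and `M = 2 deg φ_ρ · β / ((β - 1) log (1 + ε))`) such
that any two graphs on `Fin n` of maximum degree `≤ Δ` that are homomorphism-indistinguishable
over the graphs of treewidth `< C log n` satisfy `Z_G(λ) ≤ (1 + ε) Z_H(λ)` (Peters–Regts 2019,
Thm. 1.1, with Barvinok 2016, Lemma 2.2.1, §2.2.2 and Lemma 2.2.3, all proved in the tree).
[cite: PetersRegts2019, Thm. 1.1] -/
theorem logDepthContinuityBelow_proof :
    Summit.PneNP.PneNP.Theses.PhaseTwins.LogDepthContinuityBelow := by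
  intro Δ hΔ lam hlam0 hlamc ε hε
  -- Peters–Regts: a uniform zero-free `δ`-neighbourhood of `[0, λ]`
  obtain ⟨δ, hδ, hthick⟩ :=
    PetersRegts2019_zeroFree_holds.exists_thickening hΔ (t₁ := lam) hlamc
  -- the width `ρ` of Barvinok's rectangle: `0 < ρ < 1`, `4 λ ρ < δ`
  have hρ0 : 0 < δ / (4 * lam + 2 * δ) := div_pos hδ (by positivity)
  have hρ1 : δ / (4 * lam + 2 * δ) < 1 := by
    rw [div_lt_one (by positivity)]
    linarith
  have hρδ : 4 * lam * (δ / (4 * lam + 2 * δ)) < δ := by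
    rw [mul_div_assoc', div_lt_iff₀ (by positivity)]
    nlinarith
  obtain ⟨β, φ, hβ, hφ0, hφ1, hstrip⟩ :=
    DiscToStrip.exists_polynomial_disc_to_strip hρ0 hρ1
  -- the constants
  have hL0 : 0 < Real.log (1 + ε) := Real.log_pos (by linarith)
  have hβ1 : 0 < β - 1 := sub_pos.2 hβ
  set M : ℝ := 2 * φ.natDegree * β / (Real.log (1 + ε) * (β - 1)) with hM
  have hM0 : 0 ≤ M := by positivity
  refine ⟨(1 + M / Real.log 2) / Real.log β, fun n G H hG hH hhom => ?_⟩
  rw [sum_ite_isIndepSet_eq_independencePolynomial G lam,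
    sum_ite_isIndepSet_eq_independencePolynomial H lam]
  have hposG := independencePolynomial_pos G hlam0
  have hposH := independencePolynomial_pos H hlam0
  rcases Nat.lt_or_ge n 2 with hn | hn
  · -- at most one vertex: `G = H`
    rw [simpleGraph_eq_of_lt_two hn G H]
    nlinarith
  -- `n ≥ 2`: the truncation order `K = ⌊C log n⌋`
  set K : ℕ := ⌊(1 + M / Real.log 2) / Real.log β * Real.log n⌋₊ with hK
  have hlogn : 0 < Real.log n := Real.log_pos (by exact_mod_cast hn)
  have hC0 : 0 < (1 + M / Real.log 2) / Real.log β :=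
    div_pos (by have := Real.log_pos one_lt_two; positivity) (Real.log_pos hβ)
  have hKle : (K : ℝ) ≤ (1 + M / Real.log 2) / Real.log β * Real.log n :=
    Nat.floor_le (by positivity)
  -- homomorphism counts from graphs on `k ≤ K` vertices agree (treewidth `≤ k - 1 < C log n`)
  have hsmall : ∀ k ≤ K, ∀ F : SimpleGraph (Fin k), Nat.card (F →g G) = Nat.card (F →g H) := by
    intro k hk F
    have htw := treewidth_le_card_sub_one F
    rw [Fintype.card_fin] at htw
    apply hhom
    rcases Nat.eq_zero_or_pos k with rfl | hkpos
    · have h0 : treewidth F = 0 := Nat.le_zero.1 htw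
      rw [h0, Nat.cast_zero]
      positivity
    · have h2 : (k : ℝ) ≤ K := by exact_mod_cast hk
      calc (treewidth F : ℝ) ≤ ((k - 1 : ℕ) : ℝ) := by exact_mod_cast htw
        _ = k - 1 := by rw [Nat.cast_sub hkpos, Nat.cast_one]
        _ < (1 + M / Real.log 2) / Real.log β * Real.log n := by linarith
  -- hence equal numbers of independent `j`-sets, `j ≤ K`
  have hcount := fun j (hj : j ≤ K) =>
    DensityContinuityBelow.natCard_indepSets_eq_of_homCount_eq G H hsmall hj
  -- the interpolating polynomials `P_G`, `P_H`: zero-free on the disc, equal low coefficients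
  have hzG : ∀ z : ℂ, ‖z‖ < β → (∑ I : Finset (Fin n),
      if G.IsIndepSet (↑I : Set (Fin n)) then (C (lam : ℂ) * φ) ^ I.card else 0).eval z ≠ 0 :=
    fun z hz => eval_interp_ne_zero G φ hlam0 hρ0.le hρδ (hthick (Fin n) G hG) hstrip hz.le
  have hzH : ∀ z : ℂ, ‖z‖ < β → (∑ I : Finset (Fin n),
      if H.IsIndepSet (↑I : Set (Fin n)) then (C (lam : ℂ) * φ) ^ I.card else 0).eval z ≠ 0 :=
    fun z hz => eval_interp_ne_zero H φ hlam0 hρ0.le hρδ (hthick (Fin n) H hH) hstrip hz.le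
  have hcoeff : ∀ i ≤ K,
      (∑ I : Finset (Fin n),
          if G.IsIndepSet (↑I : Set (Fin n)) then (C (lam : ℂ) * φ) ^ I.card else 0).coeff i
        = (∑ I : Finset (Fin n),
          if H.IsIndepSet (↑I : Set (Fin n)) then (C (lam : ℂ) * φ) ^ I.card else 0).coeff i :=
    fun i hi => coeff_interp_eq_of_card_indepSets_eq G (lam : ℂ) φ H hφ0 hcount hi
  -- Barvinok's interpolation lemma at `z = 1`, where `P_G(1) = Z_G(λ)`
  have hB := abs_log_norm_eval_sub_log_norm_eval_le hβ hzG hzH hcoeff (z := 1) (by simp)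
  rw [eval_interp, eval_interp, hφ1, mul_one, ← ofReal_independencePolynomial,
    ← ofReal_independencePolynomial, Complex.norm_real, Complex.norm_real,
    Real.norm_of_nonneg hposG.le, Real.norm_of_nonneg hposH.le] at hB
  -- the error term is `< log (1 + ε)`
  have hN : ((∑ I : Finset (Fin n),
        if G.IsIndepSet (↑I : Set (Fin n)) then (C (lam : ℂ) * φ) ^ I.card else 0).natDegree : ℝ)
      + ((∑ I : Finset (Fin n),
        if H.IsIndepSet (↑I : Set (Fin n)) then (C (lam : ℂ) * φ) ^ I.card else 0).natDegree : ℝ)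
      ≤ 2 * φ.natDegree * n := by
    have h1 := natDegree_interp_le G (lam : ℂ) φ
    have h2 := natDegree_interp_le H (lam : ℂ) φ
    have h1' : ((∑ I : Finset (Fin n), if G.IsIndepSet (↑I : Set (Fin n))
        then (C (lam : ℂ) * φ) ^ I.card else 0).natDegree : ℝ) ≤ n * φ.natDegree := by
      exact_mod_cast h1
    have h2' : ((∑ I : Finset (Fin n), if H.IsIndepSet (↑I : Set (Fin n))
        then (C (lam : ℂ) * φ) ^ I.card else 0).natDegree : ℝ) ≤ n * φ.natDegree := by
      exact_mod_cast h2
    linarith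
  have herr := error_lt hβ hL0 hN (mul_exp_lt_pow_floor hβ hM0 hn)
  -- conclusion
  have hlt : Real.log (independencePolynomial G lam) - Real.log (independencePolynomial H lam)
      < Real.log (1 + ε) :=
    ((le_abs_self _).trans hB).trans_lt herr
  have hlt' : Real.log (independencePolynomial G lam)
      < Real.log ((1 + ε) * independencePolynomial H lam) := by
    rw [Real.log_mul (by positivity) hposH.ne']
    linarith
  exact ((Real.log_lt_log_iff hposG (by positivity)).1 hlt').le

end Summit.PneNP.PneNP.Theorems
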